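import Literature.NumberTheory.EllipticCurves.MultiplicativeTrivialTorsionDvdOrdProofs
import Literature.NumberTheory.EllipticCurves.AdditiveReductionRamifiedTorsionProofs
import Literature.NumberTheory.DiophantineGeometry.GenEllMellReduction
import HarnessLib

/-!
# Multiplicative reduction survives base change to a field over which it is semistable, and
# `2l ∣ ord_w(Δ_min(E_K))` over the `l`-division field ([IUTchI] Ex. 3.2 (iv), valuation half, K-level)

`Proofs` file (theorems only: no definition, no named fact), topic `NumberTheory/EllipticCurves`.
Sequel of `MultiplicativeTrivialTorsionDvdOrdProofs` (pointwise-rational `p`-torsion at a multiplicative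
place `v ∤ p` forces `p ∣ ord_v(Δ_min)`), moving from a curve `E/F` to its base change `E_K := E ⊗_F K`
along a finite extension of number fields `K/F` and a finite place `w` of `K` over a place `v` of `F`
(`w.asIdeal.LiesOver v.asIdeal`).

* `hasMultiplicativeReductionAt_baseChange_of_isSemistableAt` — if `E` has multiplicative reduction at
  `v` and `E_K` is semistable at `w ∣ v`, then `E_K` has MULTIPLICATIVE reduction at `w`: `|j|_w =
  |j|_v^{e(w|v)} > 1` (Silverman *AEC* VII.5.1 (b): `ord_v(j) = −ord_v(Δ_min) < 0` at a multiplicative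
  place; Mathlib's `valuation_liesOver`), which excludes good reduction (VII.5.1 (a): `|j|_w ≤ 1`).
  (Base change of multiplicative reduction for GENERAL number fields `F`, in the form the cell needs;
  the tree's `isMinimalAt_and_hasMultiplicativeReductionAt_baseChange_of_mult` is the `F = ℚ` case via
  `ℤ`-models.)
* `hasMultiplicativeReductionAt_baseChange_of_forall_smul_geomTorsion_eq` — the semistability of `E_K`
  at `w` supplied by Raynaud's criterion / [IUTchIV] Prop. 1.8 (v) (the tree's
  `isSemistableAt_of_forall_smul_geomTorsion_eq`): `Γ_K` fixes `E_K[p]` pointwise for a prime `p ≥ 3`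
  with `w ∤ p`.
* **`two_mul_dvd_ordMinimalDiscriminant_baseChange_of_forall_smul_geomTorsion_eq`** — `E/F` multiplicative
  at `v`, `l` an odd prime, `w ∣ v` with `w ∤ 2`, `w ∤ l`, and `Γ_K` fixing `E_K[2]` and `E_K[l]` pointwise
  ⟹ `2l ∣ ord_w(Δ_min(E_K))`.

Consumer (cell abc-iut; locator = WHERE it is used — the mathematics is classical): [IUTchI] Def. 3.1
(b) "`X_F` has bad [multiplicative] reduction at the elements of `𝕍(F)` that lie over `𝕍^bad_mod`",
"the `2·3`-torsion points of `E_F` are rational over `F`", (c) "`K := F(E_F[l])`", "`l` is prime to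
the elements of `𝕍^bad_mod`" (kurims manuscript, May 2020, pp. 61–62), and Example 3.2 (iv) p. 71:
"Write `q_v` for the `q`-parameter of the elliptic curve `E_v` over `K_v` … it follows from our
assumption concerning `2`-torsion, together with the definition of “`K`”, that `q_v` admits a `2l`-th
root in `𝒪^▷_{K_v}`" — at the level of VALUATIONS at a place `v̲ ∈ 𝕍(K)` over `𝕍(F)^bad`:
`2l ∣ ord_{v̲}(q_{v̲}) = ord_{v̲}(Δ_min(E_K))`, which is the last theorem (the ROOT itself, i.e. the unit
part, needs Tate uniformisation and is not claimed).  This is the clause the degree-weighted Cor. 3.12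
provenance witness (`Summits/ABC/IUTFork/Cor312ProvenanceFramesDegree.lean`, (hbadD)) and the K-level
Θ-pilot objects read.  Remaining plumbing to apply it to abc-iut-L5-t2's `InitialThetaData D`: its
fields `torsion_six_rational` / `range_K_iff` (over an abstract algebraic closure `Fbar`) ⟹ the
hypotheses `hfix2` / `hfixl` below (over `Field.absoluteGaloisGroup K`) — a convention bridge, layer L5.

## References
* [SilvermanAEC2009] J. H. Silverman, *The Arithmetic of Elliptic Curves*, GTM 106 (2nd ed.), VII.5
  Prop. 5.1 (a)(b), VII.6 Thm. 6.1.
* [SilvermanATAEC1994] J. H. Silverman, GTM 151, V.6 Prop. 6.1 (p. 410).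
* [Mochizuki2012] S. Mochizuki, *Inter-universal Teichmüller theory I*, kurims manuscript (May 2020),
  Def. 3.1 (b)(c) pp. 61–62, Example 3.2 (iv) p. 71; *IV*, Prop. 1.8 (v) p. 19 (consumer loci only).
-/

noncomputable section

open scoped Classical
open NumberField IsDedekindDomain

universe u

namespace WeierstrassCurve

open Literature.NumberTheory.EllipticCurves Literature.NumberTheory.GaloisRepresentations Field

variable {F : Type u} [Field F] [NumberField F] {K : Type u} [Field K] [NumberField K] [Algebra F K]
  (E : WeierstrassCurve F) {v : HeightOneSpectrum (𝓞 F)} {w : HeightOneSpectrum (𝓞 K)}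

omit [NumberField F] [NumberField K] in
/-- `E ⊗_F K` is elliptic when `E` is. [folklore] -/
private theorem isElliptic_baseChange' [E.IsElliptic] : (E.baseChange K).IsElliptic := by
  unfold WeierstrassCurve.baseChange; infer_instance

/-- **`|j(E_K)|_w > 1` over a multiplicative place** (Silverman *AEC* VII.5.1 (b) + `|x|_w = |x|_v^{e}`):
for `E/F` with multiplicative reduction at `v` and a place `w` of `K ⊇ F` over `v`,
`1 < w.valuation K (E ⊗ K).j`. [cite: SilvermanAEC2009, VII.5 Prop. 5.1(b)] -/
theorem one_lt_valuation_j_baseChange_of_hasMultiplicativeReductionAt [E.IsElliptic]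
    [w.asIdeal.LiesOver v.asIdeal] (hmult : E.HasMultiplicativeReductionAt v) :
    1 < w.valuation K (E.baseChange K).j := by
  have hj : (E.baseChange K).j = algebraMap F K E.j := by
    unfold WeierstrassCurve.baseChange; exact E.map_j _
  rw [hj, ← IsDedekindDomain.HeightOneSpectrum.valuation_liesOver K v w E.j]
  have h1 : 1 < v.valuation F E.j :=
    one_lt_valuation_j_of_hasMultiplicativeReduction_localMinimalModel v E hmult
  have he : v.asIdeal.ramificationIdx' w.asIdeal ≠ 0 :=
    Ideal.IsDedekindDomain.ramificationIdx'_ne_zero_of_liesOver w.asIdeal v.ne_bot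
  exact one_lt_pow₀ h1 he

/-- **Multiplicative reduction survives base change where the base change is semistable**
(Silverman *AEC* VII.5.1 (a)(b)): `E/F` multiplicative at `v`, `w ∣ v` a place of `K ⊇ F`, `E_K`
semistable at `w` ⟹ `E_K` has multiplicative reduction at `w` (good reduction would force
`|j|_w ≤ 1`). [cite: SilvermanAEC2009, VII.5 Prop. 5.1(a)(b)] -/
theorem hasMultiplicativeReductionAt_baseChange_of_isSemistableAt [E.IsElliptic]
    [w.asIdeal.LiesOver v.asIdeal] (hmult : E.HasMultiplicativeReductionAt v)
    (hsemi : (E.baseChange K).IsSemistableAt w) : (E.baseChange K).HasMultiplicativeReductionAt w := by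
  haveI := E.isElliptic_baseChange' (K := K)
  rcases hsemi with hgood | hm
  · exfalso
    have hle : w.valuation K (E.baseChange K).j ≤ 1 :=
      Literature.NumberTheory.DiophantineGeometry.GenEll.valuation_j_le_one_of_hasGoodReduction_localMinimalModel
        w (E.baseChange K) hgood
    exact absurd (E.one_lt_valuation_j_baseChange_of_hasMultiplicativeReductionAt (w := w) hmult)
      (not_lt.mpr hle)
  · exact hm

/-- **Base change of multiplicative reduction over the `p`-division field** ([IUTchIV] Prop. 1.8 (v) /
Silverman VII.6.1 for the semistability): `E/F` multiplicative at `v`, `w ∣ v` a place of `K ⊇ F` with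
`w ∤ p` (`p ≥ 3` prime) and `Γ_K` fixing `E_K[p]` pointwise ⟹ `E_K` has multiplicative reduction at `w`.
[cite: SilvermanAEC2009, VII.5 Prop. 5.1 and VII.6 Thm. 6.1] [cite: Mochizuki2012, IUTchIV Prop 1.8 (v) p.19] -/
theorem hasMultiplicativeReductionAt_baseChange_of_forall_smul_geomTorsion_eq [E.IsElliptic]
    [w.asIdeal.LiesOver v.asIdeal] (hmult : E.HasMultiplicativeReductionAt v) {p : ℕ} (hp : p.Prime)
    (hp3 : 3 ≤ p) (hpw : (p : 𝓞 K) ∉ w.asIdeal)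
    (hfix : ∀ (σ : absoluteGaloisGroup K) (Q : geomTorsion (E.baseChange K) (p : ℤ)), σ • Q = Q) :
    (E.baseChange K).HasMultiplicativeReductionAt w := by
  haveI := E.isElliptic_baseChange' (K := K)
  exact E.hasMultiplicativeReductionAt_baseChange_of_isSemistableAt hmult
    ((E.baseChange K).isSemistableAt_of_forall_smul_geomTorsion_eq hp hp3 hfix w hpw)

/-- **[IUTchI] Ex. 3.2 (iv), valuation half, at the level of `K`** (classical: Silverman VII.5.1, VII.6.1,
*ATAEC* V.6.1): `E/F` with multiplicative reduction at `v` (Def. 3.1 (b): `v ∈ 𝕍(F)^bad`), `l` an odd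
prime, `w ∣ v` a place of `K ⊇ F` with `w ∤ 2`, `w ∤ l` (Def. 3.1 (b)(c): odd residue characteristic prime
to `l`), `Γ_K` fixing `E_K[2]` (Def. 3.1 (b): `2`-torsion rational over `F ⊆ K`) and `E_K[l]`
(Def. 3.1 (c): `K = F(E_F[l])`) pointwise ⟹ `2l ∣ ord_w(Δ_min(E_K)) (= ord_w(q_w))`.
[cite: Mochizuki2012, IUTchI Ex. 3.2 (iv) p.71] [cite: SilvermanATAEC1994, V.6 Prop. 6.1 (p. 410)] -/
theorem two_mul_dvd_ordMinimalDiscriminant_baseChange_of_forall_smul_geomTorsion_eq [E.IsElliptic]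
    [w.asIdeal.LiesOver v.asIdeal] (hmult : E.HasMultiplicativeReductionAt v) {l : ℕ} (hl : l.Prime)
    (hl2 : l ≠ 2) (h2w : (2 : 𝓞 K) ∉ w.asIdeal) (hlw : (l : 𝓞 K) ∉ w.asIdeal)
    (hfix2 : ∀ (σ : absoluteGaloisGroup K) (Q : geomTorsion (E.baseChange K) (2 : ℤ)), σ • Q = Q)
    (hfixl : ∀ (σ : absoluteGaloisGroup K) (Q : geomTorsion (E.baseChange K) (l : ℤ)), σ • Q = Q) :
    2 * l ∣ (E.baseChange K).ordMinimalDiscriminant w := by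
  haveI := E.isElliptic_baseChange' (K := K)
  have hl3 : 3 ≤ l := by
    have h2 := hl.two_le
    omega
  exact (E.baseChange K).two_mul_dvd_ordMinimalDiscriminant_of_forall_smul_geomTorsion_eq
    (E.hasMultiplicativeReductionAt_baseChange_of_forall_smul_geomTorsion_eq hmult hl hl3 hlw hfixl)
    hl hl2 h2w hlw hfix2 hfixl

end WeierstrassCurve

end
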